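import Literature.Probability.LatticeModels.ClusterExpansionKPBound
import Literature.Probability.LatticeModels.PolymerPressure

/-!
# PORT-READY DRAFT of the Theorems file closing `BalabanUVNodes.PortResummationU5b` (stmt-QuantumFields-27929)

AUTHORS: statement + proof by lens-2 g2 (planner-ymgap-nodeO-lens-2-g2-0; HOME `pub/ym-nodeO-ideate/nodeO-cover/LENS-2-PortPTD-TheoremsDraft-v1.lean`
sha16 e36f7b305de70104, attached as evidence on stmt-QuantumFields-27929), kernel∕signature check by CRIT-1 g32 (`Iff.rfl` probe, ym-nodeO STATUS
l.3383; signature of record set 19:23:46Z); FILED UNCHANGED (this author line only) by dag-n07-e g36 (prover-pub-ymgap-dag-n07-e-g36-0) on director-ym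
№420 (2) ∕ №421 and chair R472 (pub-ymgap INBOX l.20262 ∕ l.20265 ∕ l.20266), `--workitem stmt-QuantumFields-27929` (count-neutral porting target PT-D).  The statement below is the LEDGER SIGNATURE OF RECORD of stmt-QuantumFields-27929 VERBATIM (FQN text set by
CRIT-1 g32 19:23:46Z, sha16 9fb1a40827d36626 = lens-2 §1 `PortResummationU5bSig` with three names fully qualified), and the
proof is §3 of `nodeO-cover/LENS-2-PortSignatures-v1.lean` byte-for-byte.  TO FILE (porter): once the gate has rendered
`def PortResummationU5b : Prop := …` into `Summits/QuantumFields/YangMills/Theses/BalabanUVNodes.lean` (not yet present at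
19:45Z — `rg PortResummationU5b` on the route file: 0 hits), put this file at
`Summits/QuantumFields/YangMills/Theorems/BalabanUVNodesPortResummationU5b.lean`, add
`import Summits.QuantumFields.YangMills.Theses.BalabanUVNodes`, and append the one-liner
`theorem portResummationU5b_holds : Summit.QuantumFields.YangMills.Theses.BalabanUVNodes.PortResummationU5b :=
  portResummationU5b_sig` (the def body is this statement, so the term elaborates by `Iff.rfl`-unfolding; if the elaborator
wants it spelled out: `by unfold Summit.…​.PortResummationU5b; exact portResummationU5b_sig`), then
`ledger propose --kind proof --target Summits/QuantumFields/YangMills/Theorems/BalabanUVNodesPortResummationU5b.lean --workitem stmt-QuantumFields-27929`.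
Imports: the KP layer only (`ClusterExpansionKPBound` for `koteckyPreiss_truncatedWeight_bound_holds`, `PolymerPressure` for
`clusterSupp`); no Bałaban carrier.  farm: rc 0 · 0 sorry · axioms {propext, Classical.choice, Quot.sound}.

HONEST: an abstract combinatorial lemma ([KP86] (4) ⟹ [II] (2.39)–(2.41) shape); nothing of Bałaban's asserted or discharged
beyond it; nothing landed by this seat; K0⁷ NOT closed; NODE O = [RG-I] Thm 3 β-clause p.264 — print-proved (claimed),
unported; U9 dictionary open; COUNT 8∕28 · K 1∕4 UNMOVED; finite 𝕋⁴ at fixed ε — NOT continuum ∕ OS ∕ Clay; the Yang–Mills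
mass gap is NOT proved by any of this.
-/

noncomputable section

namespace Summit.QuantumFields.YangMills.Theorems.PortResummationU5bDraft

open Literature.Probability.LatticeModels
open scoped BigOperators

/-- **[II] (2.39)–(2.41) abstract resummation lemma** — the ledger signature of `BalabanUVNodes.PortResummationU5b`
(stmt-QuantumFields-27929) verbatim, PROVED from the Kotecký–Preiss estimate (4) as landed
(`koteckyPreiss_truncatedWeight_bound_holds`) with `a(A) := t(ℓ A + 1)`, `d(A) := κ'(ℓ A + c₀)`, `t := ε N₁ e^{1+κ'c₀}`,
`N₁ := max N 1`, `ε₀ := (N₁ e^{1+κ'c₀})⁻¹`, `K := N₁ e^{1+κ'c₀}(c₀+1)`, read at the one-cube polymer `{x}`, `x ∈ X`.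
[cite: KoteckyPreiss1986, Theorem p.492 (1)–(4); Balaban1988RG2, (2.13) p.14, (2.27)∕(2.29)∕(2.30) p.18, (2.38)–(2.41) p.20–21] -/
theorem portResummationU5b_sig :
    ∀ (α : Type) [DecidableEq α] [Countable α] (inc : Finset α → Finset α → Prop) [DecidableRel inc] [Std.Refl inc] [Std.Symm inc], (∀ A B : Finset α, (A ∩ B).Nonempty → inc A B) → ∀ (ℓ : Finset α → ℝ) (c₀ b N : ℝ), (∀ A, 0 ≤ ℓ A) → 0 ≤ c₀ → (∀ x : α, ℓ {x} ≤ c₀) → (∀ C : Finset (Finset α), C.Nonempty → Literature.Probability.LatticeModels.IsPolymerCluster inc C → ℓ (Literature.Probability.LatticeModels.clusterSupp C) + c₀ ≤ ∑ A ∈ C, (ℓ A + c₀)) → (∀ A : Finset α, Summable (fun A' : {A' : Finset α // inc A' A} => Real.exp (-b * ℓ (A' : Finset α))) ∧ ∑' A' : {A' : Finset α // inc A' A}, Real.exp (-b * ℓ (A' : Finset α)) ≤ N * (ℓ A + 1)) → ∀ (κ κ' : ℝ), 0 ≤ κ' → κ' + b + 1 ≤ κ → ∃ ε₀ : ℝ,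 0 < ε₀ ∧ ∃ K : ℝ, 0 ≤ K ∧ ∀ (H : Finset α → ℂ) (ε : ℝ), 0 ≤ ε → ε ≤ ε₀ → (∀ A, ‖H A‖ ≤ ε * Real.exp (-κ * ℓ A)) → ∀ (𝒱 : Finset (Finset α)) (X : Finset α), X.Nonempty → ‖∑ C ∈ 𝒱.powerset with Literature.Probability.LatticeModels.clusterSupp C = X, Literature.Probability.LatticeModels.truncatedWeight inc H C‖ ≤ K * ε * Real.exp (-κ' * ℓ X) := by
  intro α _ _ inc _ _ _ hover ℓ c₀ b N hℓ hc₀ hℓ1 hsub hent κ κ' hκ' hκ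
  classical
  -- constants: `N₁ := max N 1 > 0`, `E := e^{1 + κ' c₀}`, `ε₀ := (N₁ E)⁻¹`, `K := N₁ E (c₀ + 1)`
  obtain ⟨N₁, hN₁pos, hNN₁⟩ : ∃ N₁ : ℝ, 0 < N₁ ∧ N ≤ N₁ :=
    ⟨max N 1, lt_of_lt_of_le one_pos (le_max_right N 1), le_max_left N 1⟩
  obtain ⟨E, hEpos, hE⟩ : ∃ E : ℝ, 0 < E ∧ E = Real.exp (1 + κ' * c₀) := ⟨_, Real.exp_pos _, rfl⟩
  have hNE : 0 < N₁ * E := mul_pos hN₁pos hEpos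
  refine ⟨(N₁ * E)⁻¹, inv_pos.2 hNE, N₁ * E * (c₀ + 1), mul_nonneg hNE.le (by linarith), ?_⟩
  intro H ε hε0 hεle hH 𝒱 X hX
  -- the KP data `a, d` at scale `t`
  obtain ⟨t, ht⟩ : ∃ t : ℝ, t = ε * N₁ * E := ⟨_, rfl⟩
  have ht0 : 0 ≤ t := by rw [ht]; exact mul_nonneg (mul_nonneg hε0 hN₁pos.le) hEpos.le
  have ht1 : t ≤ 1 := by
    calc t = ε * (N₁ * E) := by rw [ht]; ring
      _ ≤ (N₁ * E)⁻¹ * (N₁ * E) := mul_le_mul_of_nonneg_right hεle hNE.le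
      _ = 1 := inv_mul_cancel₀ hNE.ne'
  obtain ⟨a, ha_eq⟩ : ∃ a : Finset α → ℝ, ∀ A, a A = t * (ℓ A + 1) := ⟨_, fun _ => rfl⟩
  obtain ⟨d, hd_eq⟩ : ∃ d : Finset α → ℝ, ∀ A, d A = κ' * (ℓ A + c₀) := ⟨_, fun _ => rfl⟩
  have ha : ∀ A, 0 ≤ a A := fun A => by rw [ha_eq]; exact mul_nonneg ht0 (by linarith [hℓ A])
  have hd : ∀ A, 0 ≤ d A := fun A => by rw [hd_eq]; exact mul_nonneg hκ' (by linarith [hℓ A])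
  -- pointwise: `‖H A'‖ e^{a A' + d A'} ≤ ε E e^{-b ℓ A'}` (uses `t ≤ 1`, `κ ≥ κ' + b + 1`, `ℓ ≥ 0`)
  have hpt : ∀ A' : Finset α, ‖H A'‖ * Real.exp (a A' + d A') ≤ ε * E * Real.exp (-b * ℓ A') := by
    intro A'
    have hexp : Real.exp (-κ * ℓ A') * Real.exp (a A' + d A') ≤ E * Real.exp (-b * ℓ A') := by
      rw [← Real.exp_add, hE, ← Real.exp_add, Real.exp_le_exp, ha_eq, hd_eq]
      have : (t + κ' - κ + b) * ℓ A' ≤ 0 := mul_nonpos_of_nonpos_of_nonneg (by linarith) (hℓ A')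
      linarith
    calc ‖H A'‖ * Real.exp (a A' + d A')
        ≤ ε * Real.exp (-κ * ℓ A') * Real.exp (a A' + d A') :=
          mul_le_mul_of_nonneg_right (hH A') (Real.exp_nonneg _)
      _ = ε * (Real.exp (-κ * ℓ A') * Real.exp (a A' + d A')) := by ring
      _ ≤ ε * (E * Real.exp (-b * ℓ A')) := mul_le_mul_of_nonneg_left hexp hε0
      _ = ε * E * Real.exp (-b * ℓ A') := by ring
  -- the Kotecký–Preiss condition (1) for `(H, a, d)` from the entropy bound (2.29)∕(2.30)
  have h1 : ∀ A, Summable (fun A' : {A' : Finset α // inc A' A} =>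
        ‖H A'‖ * Real.exp (a A' + d A')) ∧
      ∑' A' : {A' : Finset α // inc A' A}, ‖H A'‖ * Real.exp (a A' + d A') ≤ a A := by
    intro A
    obtain ⟨hsum, hle⟩ := hent A
    have hsum' : Summable (fun A' : {A' : Finset α // inc A' A} =>
        ε * E * Real.exp (-b * ℓ (A' : Finset α))) := hsum.mul_left _
    have hS : Summable (fun A' : {A' : Finset α // inc A' A} => ‖H A'‖ * Real.exp (a A' + d A')) :=
      Summable.of_nonneg_of_le (fun A' => mul_nonneg (norm_nonneg _) (Real.exp_nonneg _))
        (fun A' => hpt A') hsum'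
    refine ⟨hS, ?_⟩
    calc ∑' A' : {A' : Finset α // inc A' A}, ‖H A'‖ * Real.exp (a A' + d A')
        ≤ ∑' A' : {A' : Finset α // inc A' A}, ε * E * Real.exp (-b * ℓ (A' : Finset α)) :=
          hS.tsum_le_tsum (fun A' => hpt A') hsum'
      _ = ε * E * ∑' A' : {A' : Finset α // inc A' A}, Real.exp (-b * ℓ (A' : Finset α)) :=
          tsum_mul_left
      _ ≤ ε * E * (N₁ * (ℓ A + 1)) := by
          refine mul_le_mul_of_nonneg_left (hle.trans ?_) (mul_nonneg hε0 hEpos.le)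
          exact mul_le_mul_of_nonneg_right hNN₁ (by linarith [hℓ A])
      _ = a A := by rw [ha_eq, ht]; ring
  have hfact := koteckyPreiss_truncatedWeight_bound_holds inc H a d
  have hKP : IsKPVolume inc H a 𝒱 := isKPVolume_of_tsum_le hd h1 𝒱
  obtain ⟨x, hx⟩ := hX
  -- the bound for any finite family of sub-volumes of `𝒱` with support exactly `X`
  have key : ∀ 𝒞 : Finset (Finset (Finset α)), (∀ C ∈ 𝒞, C ⊆ 𝒱 ∧ clusterSupp C = X) →
      ‖∑ C ∈ 𝒞, truncatedWeight inc H C‖ ≤ N₁ * E * (c₀ + 1) * ε * Real.exp (-κ' * ℓ X) := by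
    intro 𝒞 h𝒞
    -- every member with support `X ∋ x` contains a polymer through `x`
    have hmem : ∀ C ∈ 𝒞, ∃ A ∈ C, x ∈ A := fun C hC => by
      have hx' : x ∈ clusterSupp C := (h𝒞 C hC).2 ▸ hx
      simpa [clusterSupp] using hx'
    -- non-clusters contribute zero (KP: `Φ^T` vanishes off clusters in the KP volume `𝒱`)
    have hsum_eq : ∑ C ∈ 𝒞 with IsPolymerCluster inc C, truncatedWeight inc H C =
        ∑ C ∈ 𝒞, truncatedWeight inc H C :=
      Finset.sum_filter_of_ne fun C hC hne => by
        by_contra hCl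
        exact hne (truncatedWeight_eq_zero_of_kp hKP (h𝒞 C hC).1 hCl)
    -- every cluster with support `X` touches the one-cube polymer `{x}`
    have htouch : ∀ C ∈ 𝒞.filter (fun C => IsPolymerCluster inc C), KPTouches inc C ({x} : Finset α) := by
      intro C hC
      obtain ⟨A, hA, hxA⟩ := hmem C (Finset.mem_filter.1 hC).1
      exact ⟨A, hA, hover A {x} ⟨x, Finset.mem_inter.2 ⟨hxA, Finset.mem_singleton_self x⟩⟩⟩
    -- (2.27): on such clusters `d(C) ≥ κ' ℓ X`
    have hr : ∀ C ∈ 𝒞.filter (fun C => IsPolymerCluster inc C), KPTouches inc C ({x} : Finset α) →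
        κ' * ℓ X ≤ ∑ A ∈ C, d A := by
      intro C hC _
      have hC𝒞 := (Finset.mem_filter.1 hC).1
      have hCl : IsPolymerCluster inc C := (Finset.mem_filter.1 hC).2
      obtain ⟨A, hA, _⟩ := hmem C hC𝒞
      have h27 := hsub C ⟨A, hA⟩ hCl
      rw [(h𝒞 C hC𝒞).2] at h27
      have hX' : ℓ X ≤ ∑ A ∈ C, (ℓ A + c₀) := by linarith
      simp only [hd_eq]
      rw [← Finset.mul_sum]
      exact mul_le_mul_of_nonneg_left hX' hκ'
    -- the Kotecký–Preiss estimate (4) at `σ := {x}` with `r := κ' ℓ X`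
    have hbound := sum_norm_truncatedWeight_le_exp_neg_of_touches hfact ha hd h1
      (𝒞.filter fun C => IsPolymerCluster inc C) ({x} : Finset α) (r := κ' * ℓ X) hr
    rw [Finset.filter_true_of_mem htouch] at hbound
    rw [← hsum_eq]
    calc ‖∑ C ∈ 𝒞 with IsPolymerCluster inc C, truncatedWeight inc H C‖
        ≤ ∑ C ∈ 𝒞 with IsPolymerCluster inc C, ‖truncatedWeight inc H C‖ := norm_sum_le _ _
      _ ≤ Real.exp (-(κ' * ℓ X)) * a {x} := hbound
      _ ≤ Real.exp (-(κ' * ℓ X)) * (t * (c₀ + 1)) := by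
          rw [ha_eq]
          exact mul_le_mul_of_nonneg_left (mul_le_mul_of_nonneg_left (by linarith [hℓ1 x]) ht0)
            (Real.exp_nonneg _)
      _ = N₁ * E * (c₀ + 1) * ε * Real.exp (-κ' * ℓ X) := by rw [ht, neg_mul]; ring
  exact key _ fun C hC =>
    ⟨Finset.mem_powerset.1 (Finset.mem_filter.1 hC).1, (Finset.mem_filter.1 hC).2⟩

end Summit.QuantumFields.YangMills.Theorems.PortResummationU5bDraft

end
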